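/-
Copyright (c) 2026 the pub-hodgecm-mathlib formalisation cell (harness21).  Prover seat hodgecm-mathlib-K2Liu-p08 (g5), Track B «K2-LIT»,
#184♮ = hLiu418 = `stmt-HodgeConjecture-24832`; #42S organ S1, (G) organ ROW (ρ-mid), brick (C3-d) «PHASE DICTIONARY»: the (C3) head's block-side Rao phase
`halfForm (mulVecLin c_{tb}) y` IN THE TRACE CURRENCY OF ★ (T3a)∕(W2-e) (LEAD F0P6-plan (g14) BATCH #64∕#68; K2Liu-p08 (g5) «≠»-flag 2026-09-04T22:21:07Z).
-/
import Summits.HodgeConjecture.HodgeConjecture.Theorems.K2LiuRaoFormFrameTransport        -- (C3-d) generic half: `halfForm_cOfFix_frameSp_conj_iota` (p08)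
import Summits.HodgeConjecture.HodgeConjecture.Theorems.K2LiuTensorMiddleCellHaarDelta     -- ★ (C2b′) letters: the frame `PD`, `c_{tb}`, `frameConj_nElem`, `tensorEmbLoc_nElem` (p26)
import Summits.HodgeConjecture.HodgeConjecture.Theorems.K2LiuSiegelUnipotentPairingGram    -- ★ (T3a) `dotProduct_cOfFix_tensorEmbLoc_nElem_eq_im_trace` (p01)
import HarnessLib

/-!
# Crux `HLiu418`, #42S organ S1, (ρ-mid) brick (C3-d): THE MIDDLE-CELL PHASE OF THE (C3) HEAD IN TRACE CURRENCY —
# `halfForm (mulVecLin c_{tb}) y = halfForm (mulVecLin (cOfFix 𝕋′ (E′_ε ι(n(t) ⊗ 1) E′_ε⁻¹))) (PD·y) = ½ · im_Q(2·tr(𝕋₀ t G̃_{E′_ε}(PD·y)))`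

Cell `hodgecm-mathlib`, crux item hLiu418 = `stmt-HodgeConjecture-24832`; squad K2 ∕ K2Liu; LEAD F0P6-plan (g14); prover K2Liu-p08 (g5).
THEOREMS ONLY (no `def`, no instance, no notation, no named-fact hypothesis, no `sorry`); lane `--supports stmt-HodgeConjecture-24832 --as helper`.

WHY.  The (C3) Levi-row head of the (M2a) chain (📤 p862499 `K2LiuTensorMiddleCellLeviRow.exists_ne_zero_swSectionTensorLoc_flip_mul_nElem_mul_eq_integral_levi`,
K2Liu-p26 (g2)) keeps the phase of ★ (C2b′) verbatim: `ψ_v(−halfForm (mulVecLin c_{tb}) (x₁ ⊔ 0))`, `c_{tb} = cOfFix 𝕋_fin (π(j̃) ι_fin(n(tb)) π(j̃)⁻¹)` on the BLOCK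
model `𝕎_{T₁ ⊕ᶠ T₂}` — opaque to the three evaluation hands (inert ★ `factorisation_of_middleProfile_balls`, ramified F0P2-p07 `K2LiuNonsplitMiddleProfileRow`, split
K2Liu-p08 `K2LiuSplitWitnessMiddleProfileRow`), whose `hrow` letters all take the phase as a character applied to the hermitian Gram of the frame coordinates.
THIS FILE is the dictionary, with NO new symplectic algebra:
* §1 **`halfForm_cOfFix_boxConj_eq_tensor`** — `halfForm (mulVecLin c_{tb}) y = halfForm (mulVecLin (cOfFix 𝕋′ (E′_ε · ι′(n(t) ⊗ 1) · E′_ε⁻¹))) (frameLin PD y)` with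
  `E′_ε := π(frameMp_{PD} m)` (`m = j̃(p₁,p₂)` or ANY metaplectic element of the block datum): ★ `proj_frameMp` (`π(frameMp m) = frameSp (π m)`), ★ (Θ-3)
  `frameConj_nElem` (`PD · n_fin(tb) · PD⁻¹ = n(reindex (t ⊗ₖ 1))` under the (M1) letter `hPX`), ★ `tensorEmbLoc_nElem` (`n(t) ⊗ 1 = n(reindex (t ⊗ₖ 1))`) and the
  frame invariance of the Rao form ★∕📤 `K2LiuRaoFormFrameTransport.halfForm_cOfFix_frameSp_conj_iota`;
* §2 **`halfForm_cOfFix_boxConj_eq_half_im_trace`** — hence, by ★ (T3a) `dotProduct_cOfFix_tensorEmbLoc_nElem_eq_im_trace` at `E′_ε`,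
  `halfForm (mulVecLin c_{tb}) y = ⅟2 · im_Q(2·tr(𝕋₀ · t · G̃_{E′_ε}(frameLin PD y)))`, `G̃_{E′}(x)_{ji} = Σ_{k,l} b_{jl}·(𝕋_{V′})_{kl}·σ(b_{ik})`, `b = halfDiff(e_D⁻¹(E′⁻¹(x,0)))` —
  the (K1)∕(K2) reading of the SAME implementer `E′_ε` the (C3) head's Levi letter `hB` and the witnesses' coordinate letters speak about; with ★ (Φ4)
  `K2LiuWitnessPhaseTrace.toLocalRing_d_mul_half_pairing` (`ι(d·½y) = tr(H_t G̃)`) every hand reads `G̃` through its own (K2) letter (for ★ ED. 5: `hK2`).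
AT THE INTEGRATION POINT `y = glue (blkIdx M₂ M₂) x₁ 0` of the (C3) head, (C3-c) (K2E1-p10 (g4) `K2LiuTensorMiddleCellFrameReading`) says row `i₁` of `b` vanishes, so
`G̃` has the single non-zero entry `(i₀,i₀) = Q_{V′}(row i₀)` and the phase is `ψ_v(s_t · q)` with `ι(q)` the frame-`P` hermitian norm — the `hrow` shape.
References: [Rangarao1993] Lemma 3.2 (3.8) p. 351; [Kudla1994] §3 Thm. 3.1; [HarrisKudlaSweet1996] §1 (1.11); [Shimura1997] §13.2; [MoeglinVignerasWaldspurger1987]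
Chap. 2 II Remarque (3).
HONEST LABEL.  Count-neutral helper: `HC_CM` is proved only modulo the 7 printed citations (2 remaining named inputs: hLiu418 = `stmt-HodgeConjecture-24832`,
h413 = `stmt-HodgeConjecture-24833`) until rung 0 closes.  NOT here: (C3-b) `∃ B, hB` (K2Liu-p23), (C3-c) the frame reading (K2E1-p10), the three evaluations.

## References
* [Rangarao1993] R. Ranga Rao, Pacific J. Math. 157 (1993), Lemma 3.2 (3.8), p. 351.
* [Kudla1994] S. S. Kudla, Israel J. Math. 87 (1994), §3 Thm. 3.1.
* [HarrisKudlaSweet1996] M. Harris, S. S. Kudla, W. J. Sweet, J. Amer. Math. Soc. 9 (1996), §1 (1.11).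
* [Shimura1997] G. Shimura, *Euler Products and Eisenstein Series*, CBMS 93 (1997), §13.2.
* [MoeglinVignerasWaldspurger1987] C. Mœglin, M.-F. Vignéras, J.-L. Waldspurger, LNM 1291 (1987), Chap. 2 II Remarque (3).
-/

set_option autoImplicit false
set_option linter.dupNamespace false -- the mandated namespace repeats `HodgeConjecture.HodgeConjecture`

noncomputable section

open scoped Matrix Kronecker
open NumberField IsDedekindDomain Matrix
open Literature.RepresentationTheory.HeisenbergGroup Literature.RepresentationTheory.HeisenbergGroup.SymplecticMatrix
open Literature.NumberTheory.Automorphic Literature.NumberTheory.Automorphic.UnitaryGroup Literature.NumberTheory.Weil1964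
open Literature.NumberTheory.Automorphic.UnitaryGroup.QuadraticCoordinates
open Literature.NumberTheory.GelbartRogawski1991 Literature.NumberTheory.GelbartRogawski1991.GRConstruction
open Literature.NumberTheory.GelbartRogawski1991.AdaptedBlocks
open Literature.NumberTheory.GelbartRogawski1991.UnitaryDualPair
open Literature.NumberTheory.GelbartRogawski1991.UnitaryDualPair.LocalSplitting
open Literature.NumberTheory.GelbartRogawski1991.UnitaryDualPair.LocalSplitting.FrameTransport
open Literature.NumberTheory.GelbartRogawski1991.UnitaryDualPair.LocalSplitting.DoubledBlock
open Literature.NumberTheory.K2Lit.SiegelDoubled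
open Summit.HodgeConjecture.HodgeConjecture.Cruxes.HLiu418.K2LiuLocalSWSectionDefs
open Summit.HodgeConjecture.HodgeConjecture.Cruxes.HLiu418.K2LiuLocalSWTensorBlockFrame
open Summit.HodgeConjecture.HodgeConjecture.Cruxes.HLiu418.K2LiuLocalSWTensorBigCellLetters
open Summit.HodgeConjecture.HodgeConjecture.Cruxes.HLiu418.K2LiuSiegelUnipotentPairingGram
open Summit.HodgeConjecture.HodgeConjecture.Cruxes.HLiu418.K2LiuRaoFormFrameTransport

namespace Summit.HodgeConjecture.HodgeConjecture.Cruxes.HLiu418.K2LiuTensorMiddleCellPhaseTrace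

variable (L : Type) [Field L] [NumberField L] [IsCMField L]
variable {N M : ℕ} (e : Fin N × Fin M ≃ Fin 2)
  (dV : Fin N → L) (hdV : ∀ i, IsCMField.complexConj L (dV i) = dV i)
  (dW : Fin M → L) (hdW : ∀ i, IsCMField.complexConj L (dW i) = dW i)
variable {M₂ M' : ℕ} (eW : Fin M × Fin M₂ ≃ Fin M') (e' : Fin N × Fin M' ≃ Fin (M₂ + M₂))
  (dV' : Fin M₂ → L) (hdV' : ∀ k, IsCMField.complexConj L (dV' k) = dV' k)
  (v : HeightOneSpectrum (𝓞 (Fp L)))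
  {T₁ T₂ : Matrix (Fin M₂) (Fin M₂) (Fp L)} (hT₁ : T₁.IsSymm) (hT₂ : T₂.IsSymm)
  (P : GL (Fin (M₂ + M₂)) (Fp L))
  (hP : ((P : Matrix (Fin (M₂ + M₂)) (Fin (M₂ + M₂)) (Fp L)))ᵀ *
      gramR L e' dV hdV (tensorFrame L dW eW dV') (tensorFrame_real L dW hdW eW dV' hdV') * (P : Matrix _ _ (Fp L)) =
    UnitaryGroup.finSum M₂ M₂ T₁ T₂)
  {PD : GL (Fin ((M₂ + M₂) + (M₂ + M₂))) (Fp L)} (hPD : PD = UnitaryGroup.reindexGL (e₂ (M₂ + M₂)) (UnitaryGroup.blockDiagGL (P, P)))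

/-! ## §1 The block-side Rao phase is the tensor-side Rao phase at `PD · y` -/

include hT₁ hT₂ in
set_option maxHeartbeats 4000000 in -- MEASURED: 800000 times out at `isDefEq` (the `MpPsi.proj _ (frameMp …)` letters, as ★ (C2b′) §2 ∕ (C3) §2); 4000000 passes
/-- **THE (C3) PHASE MOVED TO THE TENSOR CURRENCY**: for ANY metaplectic element `m` of the block datum `𝕎_{T₁ ⊕ᶠ T₂}` (the (C3) head has `m = j̃(p₁,p₂)`), a skew
`t` of `U(𝕍^𝔻)(L⁺_v)` and a block-side skew `tb` with `P_v tb P_v⁻¹ = reindex epsV (t ⊗ₖ 1)` (`hPX`, the (M1) letter), and every `y`: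
`halfForm (mulVecLin c_{tb}) y = halfForm (mulVecLin (cOfFix 𝕋′ (E′_ε · ι′(n(t) ⊗ 1) · E′_ε⁻¹))) (frameLin PD y)`, `E′_ε = π(frameMp_{PD} m)`,
`c_{tb} = cOfFix 𝕋_fin (π(m) ι_fin(n(tb)) π(m)⁻¹)` — ★ `proj_frameMp`, ★ `tensorEmbLoc_nElem`, ★ `frameConj_nElem`, 📤 `halfForm_cOfFix_frameSp_conj_iota`.
[cite: MoeglinVignerasWaldspurger1987, Chap. 2 II Remarque (3)] [cite: Rangarao1993, Lemma 3.2 (3.8), p. 351] [cite: Kudla1994, §3 Thm. 3.1] -/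
theorem halfForm_cOfFix_boxConj_eq_tensor
    (m : LocalMp (Fp L) ((M₂ + M₂) + (M₂ + M₂)) (gramD (Fp L) (M₂ + M₂) (UnitaryGroup.finSum M₂ M₂ T₁ T₂)) v)
    (t : Matrix (Fin 2) (Fin 2) (LocalRing L v))
    (ht : (t.map (conjLocal L (IsCMField.complexConj L) v))ᵀ * gramS (Fp L) L v 2 (gramR L e dV hdV dW hdW) + gramS (Fp L) L v 2 (gramR L e dV hdV dW hdW) * t = 0)
    (tb : Matrix (Fin (M₂ + M₂)) (Fin (M₂ + M₂)) (LocalRing L v))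
    (htb : (tb.map (conjLocal L (IsCMField.complexConj L) v))ᵀ * gramS (Fp L) L v (M₂ + M₂) (UnitaryGroup.finSum M₂ M₂ T₁ T₂) +
      gramS (Fp L) L v (M₂ + M₂) (UnitaryGroup.finSum M₂ M₂ T₁ T₂) * tb = 0)
    (hPX : (P : Matrix (Fin (M₂ + M₂)) (Fin (M₂ + M₂)) (Fp L)).map ((UnitaryGroup.toLocalRing L v).comp (algebraMap (Fp L) (v.adicCompletion (Fp L)))) * tb *
      ((P⁻¹ : GL (Fin (M₂ + M₂)) (Fp L)) : Matrix (Fin (M₂ + M₂)) (Fin (M₂ + M₂)) (Fp L)).map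
        ((UnitaryGroup.toLocalRing L v).comp (algebraMap (Fp L) (v.adicCompletion (Fp L)))) =
      Matrix.reindex (epsV e eW e') (epsV e eW e') (t ⊗ₖ (1 : Matrix (Fin M₂) (Fin M₂) (LocalRing L v))))
    (y : Fin ((M₂ + M₂) + (M₂ + M₂)) → v.adicCompletion (Fp L)) :
    halfForm (Matrix.mulVecLin (cOfFix (localGram (Fp L) ((M₂ + M₂) + (M₂ + M₂)) (gramD (Fp L) (M₂ + M₂) (UnitaryGroup.finSum M₂ M₂ T₁ T₂)) v)
        (MpPsi.proj _ m *
          iotaD (Fp L) L (IsCMField.complexConj L) (complexConj_imagUnit L) (imagUnit_ne_zero L) (imagUnit_mul_self L) v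
            (M₂ + M₂) (UnitaryGroup.isSymm_finSum hT₁ hT₂) rfl
            (nElem (Fp L) L (IsCMField.complexConj L) v (M₂ + M₂) (T₀ := UnitaryGroup.finSum M₂ M₂ T₁ T₂) rfl tb htb) *
          (MpPsi.proj _ m)⁻¹))) y =
      halfForm (Matrix.mulVecLin (cOfFix (localGram (Fp L) ((M₂ + M₂) + (M₂ + M₂))
          (gramD (Fp L) (M₂ + M₂) (gramR L e' dV hdV (tensorFrame L dW eW dV') (tensorFrame_real L dW hdW eW dV' hdV'))) v)
        (MpPsi.proj _ (frameMp (Fp L) v ((M₂ + M₂) + (M₂ + M₂)) PD (transpose_pd_mul_gramD_mul_pd (Fp L) (M₂ + M₂) P hP hPD) m) *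
          iotaD (Fp L) L (IsCMField.complexConj L) (complexConj_imagUnit L) (imagUnit_ne_zero L) (imagUnit_mul_self L) v (M₂ + M₂)
            (gramR_isSymm L e' dV hdV (tensorFrame L dW eW dV') (tensorFrame_real L dW hdW eW dV' hdV'))
            (hermD_eq_map_gramD L e' dV hdV (tensorFrame L dW eW dV') (tensorFrame_real L dW hdW eW dV' hdV'))
            (tensorEmbLoc L e dV hdV dW hdW eW e' dV' hdV' v
              (nElem (Fp L) L (IsCMField.complexConj L) v 2 (T₀ := gramR L e dV hdV dW hdW) (hermD_eq_map_gramD L e dV hdV dW hdW) t ht)) *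
          (MpPsi.proj _ (frameMp (Fp L) v ((M₂ + M₂) + (M₂ + M₂)) PD (transpose_pd_mul_gramD_mul_pd (Fp L) (M₂ + M₂) P hP hPD) m))⁻¹)))
        (frameLin (Fp L) v ((M₂ + M₂) + (M₂ + M₂)) PD y) := by
  haveI : Algebra.IsQuadraticExtension (Fp L) L := IsCMField.isQuadraticExtension L
  rw [proj_frameMp, tensorEmbLoc_nElem L e dV hdV dW hdW eW e' dV' hdV' v t ht,
    ← frameConj_nElem (Fp L) L (IsCMField.complexConj L) v (M₂ + M₂)
      (hermD_eq_map_gramD L e' dV hdV (tensorFrame L dW eW dV') (tensorFrame_real L dW hdW eW dV' hdV')) rfl P hP hPD tb htb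
      (Matrix.reindex (epsV e eW e') (epsV e eW e') (t ⊗ₖ (1 : Matrix (Fin M₂) (Fin M₂) (LocalRing L v))))
      (skew_reindex_kronecker_one L e dV hdV dW hdW eW e' dV' hdV' v t ht) hPX]
  exact (halfForm_cOfFix_frameSp_conj_iota (Fp L) v ((M₂ + M₂) + (M₂ + M₂)) PD (transpose_pd_mul_gramD_mul_pd (Fp L) (M₂ + M₂) P hP hPD)
    L (IsCMField.complexConj L) (complexConj_imagUnit L) (imagUnit_ne_zero L) (imagUnit_mul_self L)
    (hermD_eq_map_gramD L e' dV hdV (tensorFrame L dW eW dV') (tensorFrame_real L dW hdW eW dV' hdV')) rfl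
    (gramD_isSymm (Fp L) (M₂ + M₂) (gramR_isSymm L e' dV hdV (tensorFrame L dW eW dV') (tensorFrame_real L dW hdW eW dV' hdV')))
    (gramD_isSymm (Fp L) (M₂ + M₂) (UnitaryGroup.isSymm_finSum hT₁ hT₂)) (MpPsi.proj _ m)
    (nElem (Fp L) L (IsCMField.complexConj L) v (M₂ + M₂) (T₀ := UnitaryGroup.finSum M₂ M₂ T₁ T₂) rfl tb htb) y).symm

/-! ## §2 … hence the trace form of ★ (T3a) at the implementer `E′_ε = π(frameMp_{PD} m)` -/

include hT₁ hT₂ in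
set_option maxHeartbeats 4000000 in -- MEASURED: 800000 times out at `isDefEq` (as §1); 4000000 passes
/-- **(C3-d) THE (C3) PHASE IN TRACE CURRENCY**: `halfForm (mulVecLin c_{tb}) y = ⅟2 · im_Q(2·tr(𝕋₀ · t · G̃_{E′_ε}(frameLin PD y)))` with
`G̃_{E′}(x)_{ji} = Σ_{k,l} b(epsV(j,l))·(𝕋_{V′})_{kl}·σ(b(epsV(i,k)))`, `b = halfDiff(e_D⁻¹(E′⁻¹(x,0)))` (§1 + ★ (T3a) `dotProduct_cOfFix_tensorEmbLoc_nElem_eq_im_trace`) —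
the SAME `E′_ε`, the SAME reading as the (K1)∕(K2) letters of the witness packages and as the (C3) head's Levi letter `hB`.
[cite: Kudla1994, §3 Thm. 3.1] [cite: HarrisKudlaSweet1996, §1 (1.11)] [cite: Shimura1997, §13.2] [cite: Rangarao1993, Lemma 3.2 (3.8), p. 351] -/
theorem halfForm_cOfFix_boxConj_eq_half_im_trace
    (m : LocalMp (Fp L) ((M₂ + M₂) + (M₂ + M₂)) (gramD (Fp L) (M₂ + M₂) (UnitaryGroup.finSum M₂ M₂ T₁ T₂)) v)
    (t : Matrix (Fin 2) (Fin 2) (LocalRing L v))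
    (ht : (t.map (conjLocal L (IsCMField.complexConj L) v))ᵀ * gramS (Fp L) L v 2 (gramR L e dV hdV dW hdW) + gramS (Fp L) L v 2 (gramR L e dV hdV dW hdW) * t = 0)
    (tb : Matrix (Fin (M₂ + M₂)) (Fin (M₂ + M₂)) (LocalRing L v))
    (htb : (tb.map (conjLocal L (IsCMField.complexConj L) v))ᵀ * gramS (Fp L) L v (M₂ + M₂) (UnitaryGroup.finSum M₂ M₂ T₁ T₂) +
      gramS (Fp L) L v (M₂ + M₂) (UnitaryGroup.finSum M₂ M₂ T₁ T₂) * tb = 0)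
    (hPX : (P : Matrix (Fin (M₂ + M₂)) (Fin (M₂ + M₂)) (Fp L)).map ((UnitaryGroup.toLocalRing L v).comp (algebraMap (Fp L) (v.adicCompletion (Fp L)))) * tb *
      ((P⁻¹ : GL (Fin (M₂ + M₂)) (Fp L)) : Matrix (Fin (M₂ + M₂)) (Fin (M₂ + M₂)) (Fp L)).map
        ((UnitaryGroup.toLocalRing L v).comp (algebraMap (Fp L) (v.adicCompletion (Fp L)))) =
      Matrix.reindex (epsV e eW e') (epsV e eW e') (t ⊗ₖ (1 : Matrix (Fin M₂) (Fin M₂) (LocalRing L v))))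
    (y : Fin ((M₂ + M₂) + (M₂ + M₂)) → v.adicCompletion (Fp L)) :
    halfForm (Matrix.mulVecLin (cOfFix (localGram (Fp L) ((M₂ + M₂) + (M₂ + M₂)) (gramD (Fp L) (M₂ + M₂) (UnitaryGroup.finSum M₂ M₂ T₁ T₂)) v)
        (MpPsi.proj _ m *
          iotaD (Fp L) L (IsCMField.complexConj L) (complexConj_imagUnit L) (imagUnit_ne_zero L) (imagUnit_mul_self L) v
            (M₂ + M₂) (UnitaryGroup.isSymm_finSum hT₁ hT₂) rfl
            (nElem (Fp L) L (IsCMField.complexConj L) v (M₂ + M₂) (T₀ := UnitaryGroup.finSum M₂ M₂ T₁ T₂) rfl tb htb) *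
          (MpPsi.proj _ m)⁻¹))) y =
      ⅟(2 : v.adicCompletion (Fp L)) *
        im (quadraticLocalEquiv L v (IsCMField.complexConj L) (complexConj_imagUnit L) (imagUnit_ne_zero L)).toLinearEquiv.toAddEquiv
          (2 * Matrix.trace (gramS (Fp L) L v 2 (gramR L e dV hdV dW hdW) * t *
            Matrix.of fun j i => ∑ k, ∑ l,
              halfDiff ((eD (Fp L) L (IsCMField.complexConj L) (complexConj_imagUnit L) (imagUnit_ne_zero L) (imagUnit_mul_self L) v (M₂ + M₂)).symm
                  (toLin (Fp L) v
                    (MpPsi.proj _ (frameMp (Fp L) v ((M₂ + M₂) + (M₂ + M₂)) PD (transpose_pd_mul_gramD_mul_pd (Fp L) (M₂ + M₂) P hP hPD) m))⁻¹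
                    (frameLin (Fp L) v ((M₂ + M₂) + (M₂ + M₂)) PD y, 0))) (epsV e eW e' (j, l)) *
                gramS (Fp L) L v M₂ (realDiagonal L dV' hdV') k l *
                conjLocal L (IsCMField.complexConj L) v
                  (halfDiff ((eD (Fp L) L (IsCMField.complexConj L) (complexConj_imagUnit L) (imagUnit_ne_zero L) (imagUnit_mul_self L) v (M₂ + M₂)).symm
                    (toLin (Fp L) v
                      (MpPsi.proj _ (frameMp (Fp L) v ((M₂ + M₂) + (M₂ + M₂)) PD (transpose_pd_mul_gramD_mul_pd (Fp L) (M₂ + M₂) P hP hPD) m))⁻¹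
                      (frameLin (Fp L) v ((M₂ + M₂) + (M₂ + M₂)) PD y, 0))) (epsV e eW e' (i, k))))) := by
  rw [halfForm_cOfFix_boxConj_eq_tensor L e dV hdV dW hdW eW e' dV' hdV' v hT₁ hT₂ P hP hPD m t ht tb htb hPX y, halfForm_apply, Matrix.mulVecLin_apply,
    dotProduct_cOfFix_tensorEmbLoc_nElem_eq_im_trace L e dV hdV dW hdW eW e' dV' hdV' v t ht]

end Summit.HodgeConjecture.HodgeConjecture.Cruxes.HLiu418.K2LiuTensorMiddleCellPhaseTrace

end
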